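import Summits.PneNP.PneNP.Theses.HeisenbergSparsestCut
import Summits.PneNP.PneNP.Theorems.HeisenbergSparsestCutHeisenbergGivesLasserreGaps
import Literature.Geometry.MetricEmbeddings.HeisenbergL1

/-!
# Birth skeleton for the piece `LasserreCutMetricsFarFromL1` (stmt-PneNP-2287)

The route's ENGINE line, now load-bearing for the deciding crux: Heisenberg boxes carry degree-`d`
Booleanity pseudo-cut-metrics `K(d)`-bi-Lipschitz to the word metric (crux stmt-PneNP-2286) and the
Cheeger–Kleiner–Naor distortion bound for word balls in `ℓ₁` (named Literature fact
`CheegerKleinerNaor2011_wordBall_l1Distortion`, arXiv:0910.2026 Thm 1.1, box form proved in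
`HeisenbergL1.lean`) give non-`D`-embeddable degree-`d` pseudo-cut-metrics for every `d`, `D`, via the
LANDED glue `heisenbergSparsestCut_heisenbergGivesLasserreGaps_proof` (stmt-PneNP-2291).
-/

set_option linter.dupNamespace false

namespace Summit.PneNP.PneNP.Cruxes.NoConstantApproxSparsestCut.BirthLasserreCutMetricsFarFromL1

open Summit.PneNP.PneNP.Theses.HeisenbergSparsestCut

/-- STUB 1 (= crux stmt-PneNP-2286, the engine): Heisenberg boxes are Lasserre metrics. -/
theorem stub_heisenbergBoxes : HeisenbergBoxesAreLasserreMetrics := by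
  sorry

/-- STUB 2 (named Literature fact, Cheeger–Kleiner–Naor 2011 Thm 1.1 / Cor 1.2; to be proved or kept
as the route's one cited hypothesis): `c₁(B_r, d_W) ≥ κ (log r)^δ`. -/
theorem stub_ckn : Literature.Geometry.MetricEmbeddings.CheegerKleinerNaor2011_wordBall_l1Distortion := by
  sorry

/-- COMPOSITION (kernel-checked): the piece from the two stubs, by the landed glue of stmt-PneNP-2291
and the box form of the CKN fact. -/
theorem LasserreCutMetricsFarFromL1_of
    (hBox : HeisenbergBoxesAreLasserreMetrics)
    (hCKN : Literature.Geometry.MetricEmbeddings.CheegerKleinerNaor2011_wordBall_l1Distortion) :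
    LasserreCutMetricsFarFromL1 := by
  have h := Summit.PneNP.PneNP.Theorems.heisenbergSparsestCut_heisenbergGivesLasserreGaps_proof
  unfold HeisenbergGivesLasserreGaps at h
  exact h hBox (Literature.Geometry.MetricEmbeddings.CheegerKleinerNaor2011_wordBall_l1Distortion.box hCKN)

/-- The piece from the registered stubs. -/
theorem LasserreCutMetricsFarFromL1_holds_of_stubs : LasserreCutMetricsFarFromL1 :=
  LasserreCutMetricsFarFromL1_of stub_heisenbergBoxes stub_ckn

end Summit.PneNP.PneNP.Cruxes.NoConstantApproxSparsestCut.BirthLasserreCutMetricsFarFromL1
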